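import Mathlib

/-!
# Crux `SkeletonJ1R` (stmt-NavierStokesRegularity-23610) · registered line `streamline_kantorovich_R` · stub K-B′ `KantorovichClosingBL1` —
# READ-OFF TOOLS at the waist: the slip SIGN clauses of `SwitchedTangent` from a unique transversal zero, and the eigen-clause of `RegularWaist`
# from tangency (K-notes §4(e): "reading off FINE / SwitchedTangent / RegularWaist for the fixed point: M")

Hand `leafhand-ns-filamentskeletonrs-1` g2 (prover), 2026-08-31, `--supports stmt-NavierStokesRegularity-23610 --as helper`; pure Mathlib,
route-independent.  MODEL rung, NEGATIVE side of the NS ladder; nothing here bears on Navier–Stokes regularity, which is NOT proved.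

WHY.  The Kantorovich fixed point `X` of stub K-B′ is a unit-speed curve tangent to the switched field `V` it generates, `V(X τ) = w(τ)·X′(τ)`, with
switched slip `w`, `w(0) = 0`.  Two clause groups of the output shape `FineFixedPointL` are then ONE-VARIABLE facts about `w` and a chain rule:
* `SwitchedTangent` asks `0 ≤ w` on `τ ≥ 0` and `w ≤ 0` on `τ ≤ 0` (closed sign conditions), and `RegularWaist` asks that `w` vanish ONLY at
  `τ = 0`; given the latter (from the waist analysis) and the transversal slope `w′(0) > 0` (clause-12 eigenvalue / FineClass slope `≥ 3/2 + δ/2`),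
  the former follow, in the STRICT form: `pos_of_unique_zero_of_hasDerivAt_pos` / `neg_of_unique_zero_of_hasDerivAt_pos` (`w > 0` on `(0, ∞)`,
  `w < 0` on `(−∞, 0)`: local sign from the derivative, global sign by the intermediate value theorem against uniqueness of the zero), packaged as
  the two `SwitchedTangent` clauses in `slip_signs_of_unique_zero`;
* `RegularWaist` asks that `X′(0)` be an EXACT eigenvector of `A = DV(X 0)` with positive eigenvalue, in the form `A X′0 = ⟪A X′0, X′0⟫ X′0 ∧
  0 < ⟪A X′0, X′0⟫`: differentiate the tangency at the zero (`fderiv_apply_tangent_of_tangency`: `A X′(0) = w′(0) X′(0)`, the mechanism of the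
  tree's `SelectionBoxRJRung.box_eigenvector_law`, re-derived here to stay outside the `Theses` import cone) and use unit speed
  (`regularWaist_eigen_clause`).
[folklore]
-/

set_option linter.dupNamespace false -- `NavierStokesRegularity.NavierStokesRegularity` path/namespace repetition is the tree convention

noncomputable section

namespace Summit.NavierStokesRegularity.NavierStokesRegularity.Theorems.SkeletonJ1RFrame.WaistReadOff

open Set Filter Topology
open scoped InnerProductSpace

/-! ## §1 Slip signs from a unique transversal zero -/

/-- Local positivity to the right of a zero with positive derivative: `w 0 = 0`, `w′(0) = d > 0` ⇒ `w > 0` on `(0, ε)` eventually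
(in the filter `𝓝[>] 0`). [folklore] -/
theorem eventually_pos_right_of_hasDerivAt {w : ℝ → ℝ} {d : ℝ} (h0 : w 0 = 0) (hd : HasDerivAt w d 0) (hdpos : 0 < d) :
    ∀ᶠ t in 𝓝[>] (0:ℝ), 0 < w t := by
  have hslope := hd.tendsto_slope_zero_right
  have hev : ∀ᶠ t in 𝓝[>] (0:ℝ), d / 2 < t⁻¹ • (w (0 + t) - w 0) :=
    hslope.eventually (lt_mem_nhds (by linarith))
  filter_upwards [hev, self_mem_nhdsWithin] with t ht hpos
  rw [zero_add, h0, sub_zero, smul_eq_mul] at ht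
  have hd2 : 0 < t⁻¹ * w t := lt_trans (by linarith) ht
  have htinv : 0 < t⁻¹ := inv_pos.mpr hpos
  by_contra hneg
  push Not at hneg
  have : t⁻¹ * w t ≤ 0 := mul_nonpos_of_nonneg_of_nonpos htinv.le hneg
  linarith

/-- Local negativity to the left of a zero with positive derivative: `w 0 = 0`, `w′(0) = d > 0` ⇒ `w < 0` eventually in `𝓝[<] 0`. [folklore] -/
theorem eventually_neg_left_of_hasDerivAt {w : ℝ → ℝ} {d : ℝ} (h0 : w 0 = 0) (hd : HasDerivAt w d 0) (hdpos : 0 < d) :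
    ∀ᶠ t in 𝓝[<] (0:ℝ), w t < 0 := by
  have hslope := hd.tendsto_slope_zero_left
  have hev : ∀ᶠ t in 𝓝[<] (0:ℝ), d / 2 < t⁻¹ • (w (0 + t) - w 0) :=
    hslope.eventually (lt_mem_nhds (by linarith))
  filter_upwards [hev, self_mem_nhdsWithin] with t ht hneg
  rw [zero_add, h0, sub_zero, smul_eq_mul] at ht
  have hd2 : 0 < t⁻¹ * w t := lt_trans (by linarith) ht
  have htinv : t⁻¹ < 0 := inv_lt_zero.mpr hneg
  by_contra hpos
  push Not at hpos
  have : t⁻¹ * w t ≤ 0 := mul_nonpos_of_nonpos_of_nonneg htinv.le hpos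
  linarith

/-- **Strict positivity after the waist.**  A continuous `w` with `w 0 = 0`, NO other zero, and `w′(0) > 0` is positive on `(0, ∞)`: locally by
the derivative, globally because a negative value would force a second zero by the intermediate value theorem. [folklore] -/
theorem pos_of_unique_zero_of_hasDerivAt_pos {w : ℝ → ℝ} {d : ℝ} (hw : Continuous w) (h0 : w 0 = 0)
    (huniq : ∀ τ, w τ = 0 → τ = 0) (hd : HasDerivAt w d 0) (hdpos : 0 < d) {τ : ℝ} (hτ : 0 < τ) : 0 < w τ := by
  -- a point `t₀ ∈ (0, τ)` with `w t₀ > 0`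
  have hIoo : Ioo (0:ℝ) τ ∈ 𝓝[>] (0:ℝ) := Ioo_mem_nhdsGT hτ
  obtain ⟨t₀, ht₀pos, ht₀mem⟩ := ((eventually_pos_right_of_hasDerivAt h0 hd hdpos).and
    (eventually_mem_set.mpr hIoo)).exists
  rcases lt_trichotomy 0 (w τ) with hpos | hzero | hneg
  · exact hpos
  · exact absurd (huniq τ hzero.symm) (ne_of_gt hτ)
  · -- IVT on `[t₀, τ]`: a zero strictly between `0` and `τ`
    exfalso
    have hle : t₀ ≤ τ := ht₀mem.2.le
    have hsub := intermediate_value_Icc' hle hw.continuousOn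
    have h0mem : (0:ℝ) ∈ Icc (w τ) (w t₀) := ⟨hneg.le, ht₀pos.le⟩
    obtain ⟨s, hs, hs0⟩ := hsub h0mem
    have hs00 := huniq s hs0
    have : 0 < s := lt_of_lt_of_le ht₀mem.1 hs.1
    linarith

/-- **Strict negativity before the waist** (mirror image). [folklore] -/
theorem neg_of_unique_zero_of_hasDerivAt_pos {w : ℝ → ℝ} {d : ℝ} (hw : Continuous w) (h0 : w 0 = 0)
    (huniq : ∀ τ, w τ = 0 → τ = 0) (hd : HasDerivAt w d 0) (hdpos : 0 < d) {τ : ℝ} (hτ : τ < 0) : w τ < 0 := by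
  have hIoo : Ioo τ (0:ℝ) ∈ 𝓝[<] (0:ℝ) := Ioo_mem_nhdsLT hτ
  obtain ⟨t₀, ht₀neg, ht₀mem⟩ := ((eventually_neg_left_of_hasDerivAt h0 hd hdpos).and
    (eventually_mem_set.mpr hIoo)).exists
  rcases lt_trichotomy 0 (w τ) with hpos | hzero | hneg
  · exfalso
    have hle : τ ≤ t₀ := ht₀mem.1.le
    have hsub := intermediate_value_Icc' hle hw.continuousOn
    have h0mem : (0:ℝ) ∈ Icc (w t₀) (w τ) := ⟨ht₀neg.le, hpos.le⟩
    obtain ⟨s, hs, hs0⟩ := hsub h0mem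
    have hs00 := huniq s hs0
    have : s < 0 := lt_of_le_of_lt hs.2 ht₀mem.2
    linarith
  · exact absurd (huniq τ hzero.symm) (ne_of_lt hτ)
  · exact hneg

/-- ★ The two SIGN CLAUSES of `SwitchedTangent` (closed form: `0 ≤ w` on `τ ≥ 0`, `w ≤ 0` on `τ ≤ 0`) for a continuous slip with a unique
zero at the waist and positive slope there (`HasDerivAt` form, so no differentiability elsewhere is assumed). [folklore] -/
theorem slip_signs_of_unique_zero {w : ℝ → ℝ} {d : ℝ} (hw : Continuous w) (h0 : w 0 = 0) (huniq : ∀ τ, w τ = 0 → τ = 0)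
    (hd : HasDerivAt w d 0) (hdpos : 0 < d) :
    (∀ τ, 0 ≤ τ → 0 ≤ w τ) ∧ (∀ τ, τ ≤ 0 → w τ ≤ 0) := by
  refine ⟨fun τ hτ => ?_, fun τ hτ => ?_⟩
  · rcases hτ.eq_or_lt with h | h
    · rw [← h, h0]
    · exact (pos_of_unique_zero_of_hasDerivAt_pos hw h0 huniq hd hdpos h).le
  · rcases hτ.eq_or_lt with h | h
    · rw [h, h0]
    · exact (neg_of_unique_zero_of_hasDerivAt_pos hw h0 huniq hd hdpos h).le

/-! ## §2 The eigen-clause of `RegularWaist` from tangency -/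

/-- Differentiating the tangency `V (X τ) = w τ • X′ τ` at a zero of the slip (`w c = 0`): `DV(X c) X′(c) = w′(c) X′(c)` (chain rule against
the product rule; the mechanism of the tree's `SelectionBoxRJRung.box_eigenvector_law`, re-derived to stay outside the `Theses` import cone). [folklore] -/
theorem fderiv_apply_tangent_of_tangency {V : EuclideanSpace ℝ (Fin 3) → EuclideanSpace ℝ (Fin 3)} {X : ℝ → EuclideanSpace ℝ (Fin 3)}
    {w : ℝ → ℝ} {c : ℝ} (hX : ContDiff ℝ 2 X) (hw : DifferentiableAt ℝ w c) (hwc : w c = 0) (hV : DifferentiableAt ℝ V (X c))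
    (htan : ∀ᶠ τ in 𝓝 c, V (X τ) = w τ • deriv X τ) :
    fderiv ℝ V (X c) (deriv X c) = deriv w c • deriv X c := by
  have hXd : Differentiable ℝ X := hX.differentiable (by norm_num)
  have hTd : Differentiable ℝ (deriv X) := hX.differentiable_deriv_two
  have h1 : HasDerivAt (fun τ => V (X τ)) (fderiv ℝ V (X c) (deriv X c)) c :=
    hV.hasFDerivAt.comp_hasDerivAt c (hXd c).hasDerivAt
  have h2 : HasDerivAt (fun τ => w τ • deriv X τ) (w c • deriv (deriv X) c + deriv w c • deriv X c) c :=
    hw.hasDerivAt.smul (hTd c).hasDerivAt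
  have h3 : HasDerivAt (fun τ => V (X τ)) (w c • deriv (deriv X) c + deriv w c • deriv X c) c :=
    h2.congr_of_eventuallyEq htan
  rw [h1.unique h3, hwc, zero_smul, zero_add]

/-- ★ The EIGEN-CLAUSE of `RegularWaist` for a unit-speed curve tangent to `V` near its waist zero: with `A = DV(X 0)`,
`A X′0 = ⟪A X′0, X′0⟫ X′0` and `0 < ⟪A X′0, X′0⟫` (`= w′(0) > 0`). [folklore] -/
theorem regularWaist_eigen_clause {V : EuclideanSpace ℝ (Fin 3) → EuclideanSpace ℝ (Fin 3)} {X : ℝ → EuclideanSpace ℝ (Fin 3)}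
    {w : ℝ → ℝ} {A : EuclideanSpace ℝ (Fin 3) →L[ℝ] EuclideanSpace ℝ (Fin 3)} (hA : A = fderiv ℝ V (X 0))
    (hX : ContDiff ℝ 2 X) (hunit : ‖deriv X 0‖ = 1) (hw : DifferentiableAt ℝ w 0) (hw0 : w 0 = 0) (hslope : 0 < deriv w 0)
    (hV : DifferentiableAt ℝ V (X 0)) (htan : ∀ᶠ τ in 𝓝 0, V (X τ) = w τ • deriv X τ) :
    A (deriv X 0) = ⟪A (deriv X 0), deriv X 0⟫_ℝ • deriv X 0 ∧ 0 < ⟪A (deriv X 0), deriv X 0⟫_ℝ := by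
  have hE : A (deriv X 0) = deriv w 0 • deriv X 0 := by
    rw [hA]; exact fderiv_apply_tangent_of_tangency hX hw hw0 hV htan
  have hinner : ⟪A (deriv X 0), deriv X 0⟫_ℝ = deriv w 0 := by
    rw [hE, real_inner_smul_left, real_inner_self_eq_norm_sq, hunit, one_pow, mul_one]
  rw [hinner]
  exact ⟨hE, hslope⟩

end Summit.NavierStokesRegularity.NavierStokesRegularity.Theorems.SkeletonJ1RFrame.WaistReadOff

end
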